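import Literature.AnabelianGeometry.EtaleTheta.Discharge.Sec2AutKDotted
import Literature.AnabelianGeometry.EtaleTheta.Discharge.Sec2Prop22iiOfCoverData
import Literature.AnabelianGeometry.SemiGraphs.TemperedCompletionOpenSubgroups
import HarnessLib

/-!
# [EtTh] Prop. 2.6 (characteristic nature of the dotted coverings): group-theoretic reductions and
# the canonicity of the profinite clause (proof-only companion)

Mochizuki, *The étale theta function and its Frobenioid-theoretic manifestations* [EtTh], Publ. RIMS **45**
(2009), §2, Prop. 2.6, PRIMS PDF p. 40 ll. 8–65 (printed p. 266) [cite: MochizukiEtTh2009, Prop 2.6 p.40]: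
"any isomorphism of topological groups `γ : Π^tp_{Ẋ̲̲_α} ⥲ Π^tp_{Ẋ̲̲_β}` (resp. `Ẋ̲`; `Ċ̲̲`; `Ċ̲`) induces
isomorphisms compatible with the various natural maps between the respective `Π^tp`'s of `X̲̲` (resp. `X̲`;
`C̲̲`; `C̲`) and `Ċ`. A similar statement holds when `Π^tp` is replaced by `Π`."

Cell abc-iut, layer L2, cone node EtTh:Prop2.6 (W6 tranche 2, seat abc-iut-w6-d084), companion of seat
abc-iut-L2-t2's `ThetaCoversTempered.lean` (named facts `TemperedCoverData.Prop26`, `.Prop26_profinite`,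
one-object form) and of abc-iut-L2-t7's `Discharge/Sec2Prop24Reduction.lean` (`prop26_existsUnique`: under
temp-slimness of `Π^tp_C` the extension of the TEMPERED clause is unique). PURE GROUP THEORY / TOPOLOGY over
the interface; nothing is added to it and no named fact is introduced. Writing `Ż := Z ∩ Π^tp_Ċ` for
`Z ∈ {Π^tp_{X̲̲}, Π^tp_{X̲}, Π^tp_{C̲̲}, Π^tp_{C̲}}`:

* `index_inf_PiCdot_of_mem_four` — **`[Π^tp_C : Π^tp_Ż] = 2·[Π^tp_C : Π^tp_Z]`** (`Ż → Z` is a genuine double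
  covering, `l` odd: abc-iut-L2-d3's `not_le_PiCdot_of_mem_four`), `finiteIndex_of_mem_four`,
  `finiteIndex_inf_PiCdot_of_mem_four`;
* `map_eq_self_of_restricts` — the FIRST stabilisation clause of `ExtendsStabilising` ("compatible with
  `Π^tp_Ż ⊆ Π^tp_C`") is automatic for any extension of an automorphism of `Π^tp_Ż`;
* `map_PiCdot_eq_of_map_inf_PiCdot_eq` — **the `Ċ`-clause is automatic for `Ċ̲̲`, `Ċ̲`**: an automorphism of
  `Π^tp_C` stabilising `Π^tp_Ż` stabilises `Π^tp_Ċ`, because `[Π^tp_C : Π^tp_Ż] = 2l²` resp. `2l` is not divisible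
  by `4`, so that `Π^tp_Ċ` is the unique index-`2` subgroup containing `Π^tp_Ż` (abc-iut-L2-t7's
  `Subgroup.map_eq_self_of_index_two`, the same mechanism as the `X`-clause of Prop. 2.4);
* `prop26_of_core`, `core_of_prop26`, `prop26_iff_core` — hence the typed `Prop26` is EQUIVALENT over the
  interface to its "core" form: every `γ ∈ Aut(Π^tp_Ż)` extends to `Π^tp_C` stabilising `Π^tp_Z` (and, for `Ẋ̲̲`,
  `Ẋ̲` only, `Π^tp_Ċ`) — exactly the part consumed downstream (abc-iut-L2-d3's `normalizer_inf_PiCdot_eq`,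
  Rmk. 2.6.1 / Cor. 2.9) and exactly the absolute-anabelian content of the printed proof ("entirely similar to
  the proofs of Propositions 1.8, 2.4": the `K`-core `C`, [Mzk3] Thm. 2.4) — which is NOT proved here;
* `isOpen_closure_map_toHat`, `index_closure_map_toHat` — in `Π_C` the closures `Π_Ż`, `Π_Z`, `Π_Ċ` of the images
  of the open finite-index members are OPEN, of the same index as in `Π^tp_C` (abc-iut-w5-d139's completion API
  `IsProfiniteCompletion.isOpen_topologicalClosure_map` / `comap_topologicalClosure_map` + abc-iut-L2-t7's
  `Subgroup.index_comap_of_denseRange`);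
* `prop26_profinite_existsUnique` — **the profinite clause's "induces" is canonical**: if `Π_C` is slim
  (`IsSlimGroup T.PiC` — [AbsAnab] Lemma 1.3.1 p.15 "the profinite groups `Δ_X`, `Π_X` are slim", the tree's
  `AbsoluteAnabelian.…GeomAndArithSlim`; a printed input taken BY NAME as an explicit hypothesis, exactly as
  temp-slimness of `Π^tp_C` enters `prop26_existsUnique`), the extension asserted by `Prop26_profinite` is UNIQUE;
* `map_closure_PiCdot_eq_of_map_closure_inf_eq`, `prop26_profinite_of_core` — the profinite `Ċ`-clause is likewise
  automatic for `Ċ̲̲`, `Ċ̲`, and `Prop26_profinite` follows from its core form.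

Honest framing: nothing here asserts that a `TemperedCoverData` with these properties exists or that `Prop26` /
`Prop26_profinite` hold (they remain named inputs, FACT-LIST F-0610 / F-0611); typed ≠ proved; no side is taken
on [IUTchIII] Cor. 3.12 or on any disputed claim.
-/

namespace Literature.AnabelianGeometry.EtaleTheta

open Literature.AlgebraicGeometry.Frobenioids (IsSlimGroup)
open Literature.AnabelianGeometry.SemiGraphs

namespace ThetaCovers

universe u

/-! ### Group theory: an extension of an automorphism of `H` stabilises `H` -/

section GroupTheory

variable {G : Type*} [Group G]

/-- An automorphism `Γ` of `G` that restricts on a subgroup `H` to an AUTOMORPHISM `γ` of `H` stabilises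
`H` (the first compatibility of [EtTh] Prop. 2.4/2.6 — with the inclusion `Π^tp_Ż ⊆ Π^tp_C` — is automatic).
[cite: MochizukiEtTh2009, Prop 2.6 p.40] -/
theorem map_eq_self_of_restricts {H : Subgroup G} (Γ : G ≃* G) (γ : H ≃* H)
    (h : ∀ x : H, Γ x = γ x) : H.map (Γ : G →* G) = H := by
  ext y
  constructor
  · rintro ⟨x, hx, rfl⟩
    change Γ x ∈ H
    rw [h ⟨x, hx⟩]
    exact (γ ⟨x, hx⟩).2
  · intro hy
    refine ⟨(γ.symm ⟨y, hy⟩ : H), (γ.symm ⟨y, hy⟩).2, ?_⟩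
    change Γ _ = y
    rw [h, γ.apply_symm_apply]

end GroupTheory

namespace TemperedCoverData

variable {l : ℕ} (T : TemperedCoverData.{u} l)

/-! ### Index bookkeeping for the dotted members `Π^tp_Ż = Π^tp_Z ∩ Π^tp_Ċ` -/

/-- The four undotted members `Π^tp_{X̲̲}, Π^tp_{X̲}, Π^tp_{C̲̲}, Π^tp_{C̲}` have finite index in `Π^tp_C`
(`2l², 2l, l², l`). [cite: MochizukiEtTh2009, Rmk 2.3.1 p.38] -/
theorem finiteIndex_of_mem_four {Z : Subgroup T.Gtp}
    (hZ : Z ∈ [T.tp T.PiXuu, T.tp T.PiXu, T.tp T.PiCuu, T.tp T.PiCu]) : Z.FiniteIndex := by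
  have hl := T.toCoverData.l_ne_zero
  simp only [List.mem_cons, List.mem_nil_iff, or_false] at hZ
  rcases hZ with rfl | rfl | rfl | rfl
  · refine ⟨?_⟩
    rw [T.index_tp T.isOpen_PiXuu, T.index_PiXuu]
    positivity
  · refine ⟨?_⟩
    rw [T.index_tp T.isOpen_PiXu, T.index_PiXu]
    positivity
  · refine ⟨?_⟩
    rw [T.index_tp T.isOpen_PiCuu, T.index_PiCuu]
    positivity
  · refine ⟨?_⟩
    rw [T.index_tp T.isOpen_PiCu, T.index_PiCu]
    exact hl

/-- **`[Π^tp_C : Π^tp_Ż] = 2·[Π^tp_C : Π^tp_Z]`**: `Π^tp_Ċ ⊴ Π^tp_C` has index `2` and does not contain `Π^tp_Z`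
(`l` odd), so `[Π^tp_Z : Π^tp_Ż] = 2` ("the composite … with the covering `Ċ^log → C^log`", Def. 2.5 (ii)).
[cite: MochizukiEtTh2009, Def 2.5 (ii) p.39] -/
theorem index_inf_PiCdot_of_mem_four {Z : Subgroup T.Gtp}
    (hZ : Z ∈ [T.tp T.PiXuu, T.tp T.PiXu, T.tp T.PiCuu, T.tp T.PiCu]) :
    (Z ⊓ T.PiCdot).index = Z.index * 2 := by
  haveI : T.PiCdot.Normal := Subgroup.normal_of_index_eq_two T.index_PiCdot
  have hrel : T.PiCdot.relIndex Z = 2 := by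
    have hdvd : T.PiCdot.relIndex Z ∣ 2 := T.index_PiCdot ▸ Subgroup.relIndex_dvd_index_of_normal T.PiCdot Z
    rcases (Nat.dvd_prime Nat.prime_two).mp hdvd with h1 | h2
    · exact absurd (Subgroup.relIndex_eq_one.mp h1) (T.not_le_PiCdot_of_mem_four hZ)
    · exact h2
  have h := Subgroup.relIndex_mul_index (inf_le_left : Z ⊓ T.PiCdot ≤ Z)
  rw [Subgroup.inf_relIndex_left, hrel] at h
  omega

/-- The dotted members `Π^tp_Ż` have finite index in `Π^tp_C`. [cite: MochizukiEtTh2009, Def 2.5 (ii) p.39] -/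
theorem finiteIndex_inf_PiCdot_of_mem_four {Z : Subgroup T.Gtp}
    (hZ : Z ∈ [T.tp T.PiXuu, T.tp T.PiXu, T.tp T.PiCuu, T.tp T.PiCu]) : (Z ⊓ T.PiCdot).FiniteIndex := by
  haveI := T.finiteIndex_of_mem_four hZ
  refine ⟨?_⟩
  rw [T.index_inf_PiCdot_of_mem_four hZ]
  exact Nat.mul_ne_zero Subgroup.FiniteIndex.index_ne_zero two_ne_zero

/-- The dotted members `Π^tp_Ż` are open in `Π^tp_C`. [cite: MochizukiEtTh2009, Def 2.5 (ii) p.39] -/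
theorem isOpen_inf_PiCdot_of_mem_four {Z : Subgroup T.Gtp}
    (hZ : Z ∈ [T.tp T.PiXuu, T.tp T.PiXu, T.tp T.PiCuu, T.tp T.PiCu]) :
    IsOpen ((Z ⊓ T.PiCdot : Subgroup T.Gtp) : Set T.Gtp) :=
  (T.isOpen_of_mem_four hZ).inter T.isOpen_PiCdot

/-- For the `C`-members: `[Π^tp_C : Π^tp_{Ċ̲̲}] = 2l²`, `[Π^tp_C : Π^tp_{Ċ̲}] = 2l` are NOT divisible by `4`
(`l` odd). [cite: MochizukiEtTh2009, Rmk 2.3.1 p.38] -/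
theorem not_four_dvd_index_inf_PiCdot {Z : Subgroup T.Gtp} (hZ : Z ∈ [T.tp T.PiCuu, T.tp T.PiCu]) :
    ¬ 4 ∣ (Z ⊓ T.PiCdot).index := by
  have hl : Odd l := T.l_odd
  simp only [List.mem_cons, List.mem_nil_iff, or_false] at hZ
  rcases hZ with rfl | rfl
  · rw [T.index_inf_PiCdot_of_mem_four (by simp), T.index_tp T.isOpen_PiCuu, T.index_PiCuu, ← pow_two]
    exact not_four_dvd_of_odd hl 2 (Or.inr rfl)
  · rw [T.index_inf_PiCdot_of_mem_four (by simp), T.index_tp T.isOpen_PiCu, T.index_PiCu, ← pow_one l]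
    exact not_four_dvd_of_odd hl 1 (Or.inl rfl)

/-! ### The `Ċ`-clause of Prop. 2.6 is automatic for `Ċ̲̲`, `Ċ̲` -/

/-- **The `Ċ`-clause of Prop. 2.6 is group theory for the `C`-members**: an automorphism `Γ` of `Π^tp_C`
stabilising `Π^tp_Ż` (`Z ∈ {C̲̲, C̲}`) stabilises `Π^tp_Ċ` — the unique index-`2` subgroup of `Π^tp_C` containing
`Π^tp_Ż`, as `4 ∤ [Π^tp_C : Π^tp_Ż] = 2l², 2l` (same mechanism as the `X`-clause of Prop. 2.4,
`Sec2Prop24Reduction`). [cite: MochizukiEtTh2009, Prop 2.6 p.40] -/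
theorem map_PiCdot_eq_of_map_inf_PiCdot_eq (Γ : T.Gtp ≃ₜ* T.Gtp) {Z : Subgroup T.Gtp}
    (hZ : Z ∈ [T.tp T.PiCuu, T.tp T.PiCu])
    (hΓ : (Z ⊓ T.PiCdot).map Γ.toMulEquiv.toMonoidHom = Z ⊓ T.PiCdot) :
    T.PiCdot.map Γ.toMulEquiv.toMonoidHom = T.PiCdot :=
  Subgroup.map_eq_self_of_index_two Γ.toMulEquiv T.index_PiCdot (inf_le_right : Z ⊓ T.PiCdot ≤ T.PiCdot)
    (T.not_four_dvd_index_inf_PiCdot hZ) hΓ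

/-- **Prop. 2.6 follows from its core form.** If every automorphism `γ` of `Π^tp_Ż` extends to an automorphism
of `Π^tp_C` stabilising `Π^tp_Z` — and, for the `X`-members `Ẋ̲̲`, `Ẋ̲` only, also `Π^tp_Ċ` — then the typed
`Prop26` holds: the clause "stabilises `Π^tp_Ż`" is automatic (`map_eq_self_of_restricts`) and for `Ċ̲̲`, `Ċ̲` so
is "stabilises `Π^tp_Ċ`" (`map_PiCdot_eq_of_map_inf_PiCdot_eq`). The hypothesis is the absolute-anabelian content
of the printed proof (the `K`-core `C`, "entirely similar to the proofs of Propositions 1.8, 2.4"); it is NOT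
proved here. [cite: MochizukiEtTh2009, Prop 2.6 p.40] -/
theorem prop26_of_core
    (hX : ∀ Z ∈ [T.tp T.PiXuu, T.tp T.PiXu], ∀ γ : ↥(Z ⊓ T.PiCdot) ≃ₜ* ↥(Z ⊓ T.PiCdot),
      ∃ Γ : T.Gtp ≃ₜ* T.Gtp, (∀ h : ↥(Z ⊓ T.PiCdot), Γ h = γ h) ∧
        Z.map Γ.toMulEquiv.toMonoidHom = Z ∧ T.PiCdot.map Γ.toMulEquiv.toMonoidHom = T.PiCdot)
    (hC : ∀ Z ∈ [T.tp T.PiCuu, T.tp T.PiCu], ∀ γ : ↥(Z ⊓ T.PiCdot) ≃ₜ* ↥(Z ⊓ T.PiCdot),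
      ∃ Γ : T.Gtp ≃ₜ* T.Gtp, (∀ h : ↥(Z ⊓ T.PiCdot), Γ h = γ h) ∧ Z.map Γ.toMulEquiv.toMonoidHom = Z) :
    T.Prop26 := by
  intro Z hZ γ
  have hfirst : ∀ Γ : T.Gtp ≃ₜ* T.Gtp, (∀ h : ↥(Z ⊓ T.PiCdot), Γ h = γ h) →
      (Z ⊓ T.PiCdot).map Γ.toMulEquiv.toMonoidHom = Z ⊓ T.PiCdot := fun Γ hΓ =>
    map_eq_self_of_restricts Γ.toMulEquiv γ.toMulEquiv hΓ
  have hZ' : Z ∈ [T.tp T.PiXuu, T.tp T.PiXu] ∨ Z ∈ [T.tp T.PiCuu, T.tp T.PiCu] := by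
    simp only [List.mem_cons, List.mem_nil_iff, or_false] at hZ ⊢
    tauto
  rcases hZ' with hZX | hZC
  · obtain ⟨Γ, hΓ, hZst, hCst⟩ := hX Z hZX γ
    refine ⟨Γ, hΓ, fun S hS => ?_⟩
    simp only [List.mem_cons, List.mem_nil_iff, or_false] at hS
    rcases hS with rfl | rfl | rfl
    · exact hfirst Γ hΓ
    · exact hZst
    · exact hCst
  · obtain ⟨Γ, hΓ, hZst⟩ := hC Z hZC γ
    refine ⟨Γ, hΓ, fun S hS => ?_⟩
    simp only [List.mem_cons, List.mem_nil_iff, or_false] at hS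
    rcases hS with rfl | rfl | rfl
    · exact hfirst Γ hΓ
    · exact hZst
    · exact T.map_PiCdot_eq_of_map_inf_PiCdot_eq Γ hZC (hfirst Γ hΓ)

/-- Conversely the typed `Prop26` contains its core form (projection; recorded so that the two are seen to be
EQUIVALENT over the interface). [cite: MochizukiEtTh2009, Prop 2.6 p.40] -/
theorem core_of_prop26 (h : T.Prop26) {Z : Subgroup T.Gtp}
    (hZ : Z ∈ [T.tp T.PiXuu, T.tp T.PiXu, T.tp T.PiCuu, T.tp T.PiCu])
    (γ : ↥(Z ⊓ T.PiCdot) ≃ₜ* ↥(Z ⊓ T.PiCdot)) :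
    ∃ Γ : T.Gtp ≃ₜ* T.Gtp, (∀ h : ↥(Z ⊓ T.PiCdot), Γ h = γ h) ∧
      Z.map Γ.toMulEquiv.toMonoidHom = Z ∧ T.PiCdot.map Γ.toMulEquiv.toMonoidHom = T.PiCdot := by
  obtain ⟨Γ, hΓ, hst⟩ := h Z hZ γ
  exact ⟨Γ, hΓ, hst Z (by simp), hst T.PiCdot (by simp)⟩

/-- **`Prop26` is EQUIVALENT over the interface to its core form** (`prop26_of_core` / `core_of_prop26`).
[cite: MochizukiEtTh2009, Prop 2.6 p.40] -/
theorem prop26_iff_core :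
    T.Prop26 ↔
      ((∀ Z ∈ [T.tp T.PiXuu, T.tp T.PiXu], ∀ γ : ↥(Z ⊓ T.PiCdot) ≃ₜ* ↥(Z ⊓ T.PiCdot),
        ∃ Γ : T.Gtp ≃ₜ* T.Gtp, (∀ h : ↥(Z ⊓ T.PiCdot), Γ h = γ h) ∧
          Z.map Γ.toMulEquiv.toMonoidHom = Z ∧ T.PiCdot.map Γ.toMulEquiv.toMonoidHom = T.PiCdot) ∧
      (∀ Z ∈ [T.tp T.PiCuu, T.tp T.PiCu], ∀ γ : ↥(Z ⊓ T.PiCdot) ≃ₜ* ↥(Z ⊓ T.PiCdot),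
        ∃ Γ : T.Gtp ≃ₜ* T.Gtp, (∀ h : ↥(Z ⊓ T.PiCdot), Γ h = γ h) ∧ Z.map Γ.toMulEquiv.toMonoidHom = Z)) := by
  constructor
  · intro h
    refine ⟨fun Z hZ γ => T.core_of_prop26 h ?_ γ, fun Z hZ γ => ?_⟩
    · simp only [List.mem_cons, List.mem_nil_iff, or_false] at hZ ⊢
      tauto
    · have hZ4 : Z ∈ [T.tp T.PiXuu, T.tp T.PiXu, T.tp T.PiCuu, T.tp T.PiCu] := by
        simp only [List.mem_cons, List.mem_nil_iff, or_false] at hZ ⊢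
        tauto
      obtain ⟨Γ, hΓ, hZst, -⟩ := T.core_of_prop26 h hZ4 γ
      exact ⟨Γ, hΓ, hZst⟩
  · rintro ⟨hX, hC⟩
    exact T.prop26_of_core hX hC

/-! ### The profinite clause: closures in `Π_C`, and canonicity under slimness of `Π_C` -/

/-- In `Π_C` (the profinite completion of `Π^tp_C`), the closure of the image of an OPEN subgroup of FINITE
index of `Π^tp_C` is OPEN ("A similar statement holds when `Π^tp` is replaced by `Π`": the profinite `Π_Ż`,
`Π_Z`, `Π_Ċ` are these closures). [cite: MochizukiEtTh2009, Prop 2.6 p.40] -/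
theorem isOpen_closure_map_toHat (S : Subgroup T.Gtp) (hS : IsOpen (S : Set T.Gtp)) [S.FiniteIndex] :
    IsOpen (((S.map T.toHat).topologicalClosure : Subgroup T.PiC) : Set T.PiC) :=
  IsProfiniteCompletion.isOpen_topologicalClosure_map T.isProfiniteCompletion_toHat S hS

/-- … and has the same index: `[Π_C : Π_Ż] = [Π^tp_C : Π^tp_Ż]` etc. [cite: MochizukiEtTh2009, Prop 2.6 p.40] -/
theorem index_closure_map_toHat (S : Subgroup T.Gtp) (hS : IsOpen (S : Set T.Gtp)) [S.FiniteIndex] :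
    ((S.map T.toHat).topologicalClosure).index = S.index := by
  -- `toHat⁻¹(closure (toHat S)) = S` (w5-d139) and indices of OPEN subgroups survive the dense `toHat` (L2-t7)
  have h1 := Subgroup.index_comap_of_denseRange T.toHat T.isProfiniteCompletion_toHat.denseRange
    ((S.map T.toHat).topologicalClosure) (T.isOpen_closure_map_toHat S hS)
  have h2 : ((S.map T.toHat).topologicalClosure).comap T.toHat = S :=
    IsProfiniteCompletion.comap_topologicalClosure_map T.isProfiniteCompletion_toHat S hS
  rw [← h1, h2]

/-- `[Π_C : closure of Π^tp_Ċ] = 2`. [cite: MochizukiEtTh2009, Prop 2.6 p.40] -/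
theorem index_closure_map_PiCdot : ((T.PiCdot.map T.toHat).topologicalClosure).index = 2 := by
  haveI : T.PiCdot.FiniteIndex := ⟨by rw [T.index_PiCdot]; exact two_ne_zero⟩
  rw [T.index_closure_map_toHat T.PiCdot T.isOpen_PiCdot, T.index_PiCdot]

/-- **Prop. 2.6, profinite clause, with uniqueness** (slim form): if `Π_C` is slim then the extension to `Π_C`
of an automorphism of the profinite `Π_Ż` asserted by `Prop26_profinite` is UNIQUE — two continuous automorphisms
of `Π_C` agreeing on the open subgroup `Π_Ż` coincide (`IsSlimGroup.continuousMulEquiv_eq_of_eqOn`). Inputs BY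
NAME: `T.Prop26_profinite` (the typed named fact) and `IsSlimGroup T.PiC` (slimness of the profinite `Π_C`,
[AbsAnab] Lem. 1.3.1; not a field of the interface).
[cite: MochizukiEtTh2009, Prop 2.6 p.40] -/
theorem prop26_profinite_existsUnique (hslim : IsSlimGroup T.PiC) (h : T.Prop26_profinite)
    {Z : Subgroup T.Gtp} (hZ : Z ∈ [T.tp T.PiXuu, T.tp T.PiXu, T.tp T.PiCuu, T.tp T.PiCu])
    (γ : ((Z ⊓ T.PiCdot).map T.toHat).topologicalClosure ≃ₜ*
      ((Z ⊓ T.PiCdot).map T.toHat).topologicalClosure) :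
    ∃! Γ : T.PiC ≃ₜ* T.PiC, (∀ x : ((Z ⊓ T.PiCdot).map T.toHat).topologicalClosure, Γ x = γ x) ∧
      ∀ S ∈ [Z ⊓ T.PiCdot, Z, T.PiCdot],
        ((S.map T.toHat).topologicalClosure).map Γ.toMulEquiv.toMonoidHom =
          (S.map T.toHat).topologicalClosure := by
  haveI := T.finiteIndex_inf_PiCdot_of_mem_four hZ
  have hopen := T.isOpen_closure_map_toHat (Z ⊓ T.PiCdot) (T.isOpen_inf_PiCdot_of_mem_four hZ)
  obtain ⟨Γ, hΓ, hst⟩ := h Z hZ γ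
  refine ⟨Γ, ⟨hΓ, hst⟩, fun Γ' hΓ' => ?_⟩
  exact hslim.continuousMulEquiv_eq_of_eqOn hopen Γ' Γ fun x hx => by rw [hΓ'.1 ⟨x, hx⟩, hΓ ⟨x, hx⟩]

/-- **The profinite `Ċ`-clause is automatic for `Ċ̲̲`, `Ċ̲`**: a (continuous) automorphism of `Π_C` stabilising
the closure `Π_Ż` of `Π^tp_Ż` stabilises the closure `Π_Ċ` of `Π^tp_Ċ` — the unique index-`2` subgroup of `Π_C`
containing `Π_Ż` (`[Π_C : Π_Ż] = [Π^tp_C : Π^tp_Ż] = 2l², 2l`, not divisible by `4`).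
[cite: MochizukiEtTh2009, Prop 2.6 p.40] -/
theorem map_closure_PiCdot_eq_of_map_closure_inf_eq (Γ : T.PiC ≃ₜ* T.PiC) {Z : Subgroup T.Gtp}
    (hZ : Z ∈ [T.tp T.PiCuu, T.tp T.PiCu])
    (hΓ : (((Z ⊓ T.PiCdot).map T.toHat).topologicalClosure).map Γ.toMulEquiv.toMonoidHom =
      ((Z ⊓ T.PiCdot).map T.toHat).topologicalClosure) :
    ((T.PiCdot.map T.toHat).topologicalClosure).map Γ.toMulEquiv.toMonoidHom =
      (T.PiCdot.map T.toHat).topologicalClosure := by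
  have hZ4 : Z ∈ [T.tp T.PiXuu, T.tp T.PiXu, T.tp T.PiCuu, T.tp T.PiCu] := by
    simp only [List.mem_cons, List.mem_nil_iff, or_false] at hZ ⊢
    tauto
  haveI := T.finiteIndex_inf_PiCdot_of_mem_four hZ4
  have h4 : ¬ 4 ∣ (((Z ⊓ T.PiCdot).map T.toHat).topologicalClosure).index := by
    rw [T.index_closure_map_toHat (Z ⊓ T.PiCdot) (T.isOpen_inf_PiCdot_of_mem_four hZ4)]
    exact T.not_four_dvd_index_inf_PiCdot hZ
  exact Subgroup.map_eq_self_of_index_two Γ.toMulEquiv T.index_closure_map_PiCdot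
    (Subgroup.topologicalClosure_mono (Subgroup.map_mono inf_le_right)) h4 hΓ

/-- **The profinite clause follows from its core form** (same reductions as `prop26_of_core`, in `Π_C`):
if every continuous automorphism of the profinite `Π_Ż` extends to `Π_C` stabilising `Π_Z` (the closure of
`Π^tp_Z`) — and, for `Ẋ̲̲`, `Ẋ̲` only, `Π_Ċ` — then the typed `Prop26_profinite` holds. The hypothesis is the
absolute-anabelian content; it is NOT proved here. [cite: MochizukiEtTh2009, Prop 2.6 p.40] -/
theorem prop26_profinite_of_core
    (hX : ∀ Z ∈ [T.tp T.PiXuu, T.tp T.PiXu],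
      ∀ γ : ((Z ⊓ T.PiCdot).map T.toHat).topologicalClosure ≃ₜ*
          ((Z ⊓ T.PiCdot).map T.toHat).topologicalClosure,
      ∃ Γ : T.PiC ≃ₜ* T.PiC, (∀ h : ((Z ⊓ T.PiCdot).map T.toHat).topologicalClosure, Γ h = γ h) ∧
        ((Z.map T.toHat).topologicalClosure).map Γ.toMulEquiv.toMonoidHom =
          (Z.map T.toHat).topologicalClosure ∧
        ((T.PiCdot.map T.toHat).topologicalClosure).map Γ.toMulEquiv.toMonoidHom =
          (T.PiCdot.map T.toHat).topologicalClosure)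
    (hC : ∀ Z ∈ [T.tp T.PiCuu, T.tp T.PiCu],
      ∀ γ : ((Z ⊓ T.PiCdot).map T.toHat).topologicalClosure ≃ₜ*
          ((Z ⊓ T.PiCdot).map T.toHat).topologicalClosure,
      ∃ Γ : T.PiC ≃ₜ* T.PiC, (∀ h : ((Z ⊓ T.PiCdot).map T.toHat).topologicalClosure, Γ h = γ h) ∧
        ((Z.map T.toHat).topologicalClosure).map Γ.toMulEquiv.toMonoidHom =
          (Z.map T.toHat).topologicalClosure) :
    T.Prop26_profinite := by
  intro Z hZ γ
  have hfirst : ∀ Γ : T.PiC ≃ₜ* T.PiC,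
      (∀ h : ((Z ⊓ T.PiCdot).map T.toHat).topologicalClosure, Γ h = γ h) →
      (((Z ⊓ T.PiCdot).map T.toHat).topologicalClosure).map Γ.toMulEquiv.toMonoidHom =
        ((Z ⊓ T.PiCdot).map T.toHat).topologicalClosure := fun Γ hΓ =>
    map_eq_self_of_restricts Γ.toMulEquiv γ.toMulEquiv hΓ
  have hZ' : Z ∈ [T.tp T.PiXuu, T.tp T.PiXu] ∨ Z ∈ [T.tp T.PiCuu, T.tp T.PiCu] := by
    simp only [List.mem_cons, List.mem_nil_iff, or_false] at hZ ⊢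
    tauto
  rcases hZ' with hZX | hZC
  · obtain ⟨Γ, hΓ, hZst, hCst⟩ := hX Z hZX γ
    refine ⟨Γ, hΓ, fun S hS => ?_⟩
    simp only [List.mem_cons, List.mem_nil_iff, or_false] at hS
    rcases hS with rfl | rfl | rfl
    · exact hfirst Γ hΓ
    · exact hZst
    · exact hCst
  · obtain ⟨Γ, hΓ, hZst⟩ := hC Z hZC γ
    refine ⟨Γ, hΓ, fun S hS => ?_⟩
    simp only [List.mem_cons, List.mem_nil_iff, or_false] at hS
    rcases hS with rfl | rfl | rfl
    · exact hfirst Γ hΓ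
    · exact hZst
    · exact T.map_closure_PiCdot_eq_of_map_closure_inf_eq Γ hZC (hfirst Γ hΓ)

end TemperedCoverData

end ThetaCovers

end Literature.AnabelianGeometry.EtaleTheta
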